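import Mathlib.LinearAlgebra.Matrix.ToLinearEquiv
import Mathlib.LinearAlgebra.Matrix.Symmetric
import Mathlib.LinearAlgebra.Matrix.Rank
import Mathlib.Algebra.Field.ZMod
import HarnessLib

/-!
# Cell qa-qnc0 (route RingFrame, crux α, line `tensor`): KERNEL VECTOR = PRINCIPAL COFACTORS
# (qn-p2 ROUND-6 §4, ask R6-b; the graph-agnostic form of the ring game's hidden parity check)

Planner qa-qnc0-p2's ROUND-6 §4 rewrites the graph-state HLF check on a graph `G` as `⟨z(x), ∇ det(A_G + diag x)⟩`:
on inputs where `M(x) = A_G + diag x` has corank one, its kernel vector is the vector of PRINCIPAL COFACTORS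
(`adj M = u uᵀ`).  This file proves the underlying finite linear-algebra statement, typed VERBATIM from
`HOME/qa-qnc0-p2/line/Sketch6.lean`:

* `kernelEqCofactors : KernelEqCofactors` — for a symmetric `(n+1) × (n+1)` matrix `M` over `𝔽₂` of rank `n`
  and a non-zero `u` with `M u = 0`: `u_i = det M^{(i)}` (row and column `i` deleted) for every `i`.

Proof (elementary, avoiding the adjugate): `ker M = {0, u}` (rank–nullity).  If `u_i = 0`, `u` restricted to the
other coordinates is a non-zero kernel vector of `M^{(i)}`, so `det M^{(i)} = 0`.  If `u_i = 1` and `M^{(i)} v' = 0`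
with `v' ≠ 0`, extend `v'` by `v_i = 0`: then `(Mv)_j = 0` for `j ≠ i`; if also `(Mv)_i = 0` then `v ∈ ker M`,
`v = u`, contradicting `v_i = 0 ≠ u_i`; otherwise `uᵀ M v = u_i (Mv)_i = 1`, while `uᵀ M v = (Mu)ᵀ v = 0` by symmetry.
So `det M^{(i)} ≠ 0`, i.e. `= 1 = u_i` in `𝔽₂`.

The cell's lemma (planner qa-qnc0-p2 gen 6; seat qa-qnc0-lit gen 11, 2026-08-27).  WHAT THIS IS NOT: nothing about
the determinant formula for the cycle `C_n` (ROUND-6 §4, checked numerically only), nothing on α or the separation.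
-/

namespace Summit.QuantumAdvantage.AdviceFreeQNC0

open Matrix Module

/-- **KERNEL = GRADIENT OF THE DETERMINANT** (qn-p2 ROUND-6 §4, `Sketch6.KernelEqCofactors` verbatim): for a
symmetric matrix `M` over `𝔽₂` of corank exactly one, the nonzero kernel vector is the vector of principal cofactors
`u_i = det M^{(i)}`. -/
def KernelEqCofactors : Prop :=
  ∀ (n : ℕ) (M : Matrix (Fin (n + 1)) (Fin (n + 1)) (ZMod 2)), M.IsSymm → M.rank = n →
    ∀ u : Fin (n + 1) → ZMod 2, u ≠ 0 → M.mulVec u = 0 →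
      ∀ i, u i = (M.submatrix (Fin.succAbove i) (Fin.succAbove i)).det

namespace KernelEqCofactors

/-- In `𝔽₂`, two non-zero elements are equal. -/
private theorem zmod2_eq_of_ne_zero {x y : ZMod 2} (hx : x ≠ 0) (hy : y ≠ 0) : x = y := by
  revert x y; decide

/-- **Rank `n` on `n + 1` coordinates: the kernel is `{0, u}`** for any non-zero kernel vector `u`. -/
theorem eq_zero_or_eq_of_mulVec_eq_zero {n : ℕ} {M : Matrix (Fin (n + 1)) (Fin (n + 1)) (ZMod 2)}
    (hr : M.rank = n) {u : Fin (n + 1) → ZMod 2} (hu0 : u ≠ 0) (hu : M.mulVec u = 0)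
    {v : Fin (n + 1) → ZMod 2} (hv : M.mulVec v = 0) : v = 0 ∨ v = u := by
  have hk : finrank (ZMod 2) (LinearMap.ker M.mulVecLin) = 1 := by
    have h := LinearMap.finrank_range_add_finrank_ker M.mulVecLin
    rw [Module.finrank_fintype_fun_eq_card, Fintype.card_fin] at h
    have hr' : finrank (ZMod 2) (LinearMap.range M.mulVecLin) = n := hr
    omega
  have huk : u ∈ LinearMap.ker M.mulVecLin := by rw [LinearMap.mem_ker, Matrix.mulVecLin_apply]; exact hu
  have hvk : v ∈ LinearMap.ker M.mulVecLin := by rw [LinearMap.mem_ker, Matrix.mulVecLin_apply]; exact hv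
  have hu' : (⟨u, huk⟩ : LinearMap.ker M.mulVecLin) ≠ 0 := fun h => hu0 (congrArg Subtype.val h)
  obtain ⟨c, hc⟩ := (finrank_eq_one_iff_of_nonzero' _ hu').1 hk ⟨v, hvk⟩
  have hc' : c • u = v := congrArg Subtype.val hc
  have hc2 : ∀ c : ZMod 2, c = 0 ∨ c = 1 := by decide
  rcases hc2 c with h | h
  · left; rw [← hc', h, zero_smul]
  · right; rw [← hc', h, one_smul]

end KernelEqCofactors

open KernelEqCofactors in
/-- **`kernelEqCofactors : KernelEqCofactors`** — the kernel vector of a corank-one symmetric `𝔽₂`-matrix is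
the vector of its principal cofactors. [folklore] -/
theorem kernelEqCofactors : KernelEqCofactors := by
  intro n M hM hr u hu0 hu i
  classical
  set S := M.submatrix i.succAbove i.succAbove with hS
  -- row `i.succAbove l` of `M *ᵥ v`, split into the `i`-term and the `S`-part
  have hrow : ∀ (v : Fin (n + 1) → ZMod 2) (l : Fin n),
      (M.mulVec v) (i.succAbove l) =
        M (i.succAbove l) i * v i + (S.mulVec fun l' => v (i.succAbove l')) l := by
    intro v l
    simp only [Matrix.mulVec, dotProduct, hS, Matrix.submatrix_apply]
    rw [Fin.sum_univ_succAbove _ i]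
  by_cases hui : u i = 0
  · -- `u` restricted is a non-zero kernel vector of `S`
    have hdet : S.det = 0 := by
      refine Matrix.exists_mulVec_eq_zero_iff.1 ⟨fun l => u (i.succAbove l), ?_, ?_⟩
      · intro h0
        apply hu0
        funext k
        by_cases hk : k = i
        · rw [hk, hui]; rfl
        · obtain ⟨l, rfl⟩ := Fin.exists_succAbove_eq hk
          exact congrFun h0 l
      · funext l
        have h := hrow u l
        rw [congrFun hu (i.succAbove l), hui, mul_zero, zero_add] at h
        exact h.symm
    rw [hui, hdet]
  · -- `u i ≠ 0`: `S` is non-singular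
    have hdet : S.det ≠ 0 := by
      intro hdet
      obtain ⟨v', hv'0, hv'⟩ := Matrix.exists_mulVec_eq_zero_iff.2 hdet
      set v : Fin (n + 1) → ZMod 2 := Fin.insertNth (α := fun _ => ZMod 2) i 0 v' with hvdef
      have hvi : v i = 0 := by rw [hvdef]; exact Fin.insertNth_apply_same (α := fun _ => ZMod 2) i 0 v'
      have hvl : ∀ l, v (i.succAbove l) = v' l := fun l => by
        rw [hvdef]; exact Fin.insertNth_apply_succAbove (α := fun _ => ZMod 2) i 0 v' l
      have hrestr : (fun l' => v (i.succAbove l')) = v' := funext hvl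
      have hoff : ∀ l, (M.mulVec v) (i.succAbove l) = 0 := by
        intro l
        rw [hrow v l, hvi, mul_zero, zero_add, hrestr, hv']
        rfl
      have hv0 : v ≠ 0 := by
        intro h
        apply hv'0
        funext l
        rw [← hvl l, h]
        rfl
      by_cases hβ : (M.mulVec v) i = 0
      · -- `v ∈ ker M = {0, u}`: contradiction at coordinate `i`
        have hMv : M.mulVec v = 0 := by
          funext k
          by_cases hk : k = i
          · rw [hk]; exact hβ
          · obtain ⟨l, rfl⟩ := Fin.exists_succAbove_eq hk
            exact hoff l
        rcases eq_zero_or_eq_of_mulVec_eq_zero hr hu0 hu hMv with h | h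
        · exact hv0 h
        · apply hui
          rw [← h]
          exact hvi
      · -- `u ⬝ (M v) = u_i · (M v)_i ≠ 0`, but `u ⬝ (M v) = (M u) ⬝ v = 0` by symmetry
        have h1 : u ⬝ᵥ M.mulVec v = u i * (M.mulVec v) i := by
          unfold dotProduct
          rw [Fin.sum_univ_succAbove _ i]
          simp [hoff]
        have h2 : u ⬝ᵥ M.mulVec v = 0 := by
          rw [Matrix.dotProduct_mulVec, ← Matrix.mulVec_transpose, hM.eq, hu, zero_dotProduct]
        rw [h2] at h1
        exact mul_ne_zero hui hβ h1.symm
    exact zmod2_eq_of_ne_zero hui hdet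

end Summit.QuantumAdvantage.AdviceFreeQNC0
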